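import Literature.NumberTheory.Automorphic.LanglandsTunnellModThree
import Literature.NumberTheory.Automorphic.StrongArtinGL2
import Literature.NumberTheory.Automorphic.SerreConjecture
import Literature.NumberTheory.EllipticCurves.CMNewformGamma0OfGrossencharakter
import HarnessLib

/-!
# Stub-ideation k1 (HOME FAMILY 1 — recognise & import) for `stub_modThree`

Helper-lemma SIGNATURES for the plans in `STUB-IDEAS-stub_modThree-1.md`.  Every `sorry` below is
a proposed helper (one prover cycle each); the assembly theorems (`stub_modThree_of_…`) are REAL
proofs from the helpers, showing helpers ⇒ stub.  Nothing here is registered; the stub's statement is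
copied verbatim as `StubModThree`.
-/

noncomputable section

open scoped MatrixGroups NumberField Polynomial
open NumberField IsDedekindDomain Polynomial CongruenceSubgroup
open Literature.NumberTheory.EllipticCurves
open Literature.NumberTheory.EllipticCurves.ModularForms
open Literature.NumberTheory.Automorphic
open Literature.NumberTheory.GaloisRepresentations
open Literature.NumberTheory.GaloisRepresentations.GL2F3Lift
open Literature.NumberTheory.LFunctions
open WeierstrassCurve

set_option linter.dupNamespace false

namespace Summit.ABC.ABC.Cruxes.FreyModularity.Sketch.StubModThreeIdeasK1

/-- The registered stub statement, verbatim. -/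
def StubModThree : Prop :=
  ∀ (W : WeierstrassCurve ℚ) [W.IsElliptic] (ρ : ModPGaloisRep ℚ (ZMod 3) 2),
    W.IsTorsionGaloisRep 3 ρ → FramedRep.IsAbsolutelyIrreducible ρ → ρ.IsModular

/-- Sanity: the tree's closer has exactly this type (`BCDT.modThree_of_langlands_tunnell` of
`CDTTheorem712TwoLiftsProofs` is this term). -/
theorem stubModThree_of_langlands_tunnell (hLT : ∀ σ : FramedArtinRep ℚ 2, langlands_tunnell σ) :
    StubModThree :=
  fun W _ ρ hρ habs ↦ W.isModular_of_isTorsionGaloisRep_three_of_langlands_tunnell hLT ρ hρ habs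

/-! ## Plan A — per-σ Langlands–Tunnell; odd ⇒ not tetrahedral; two cases (dihedral, octahedral) -/

/-- **H0** `ρ̄_{E,3}` is odd (Weil pairing: `det ρ̄ = χ̄₃`, `χ̄₃(c) = -1`).  Extract the 5-line
`have hodd` of `WeierstrassCurve.isModular_of_isTorsionGaloisRep_three_of_langlands_tunnell`
(`det_eq_modPCyclotomicCharacter_of_isTorsionGaloisRep_holds`, `modNCyclotomicCharacter_of_isComplexConjugation`). S. -/
theorem isOdd_of_isTorsionGaloisRep_three (W : WeierstrassCurve ℚ) [W.IsElliptic]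
    (ρ : ModPGaloisRep ℚ (ZMod 3) 2) (hρ : W.IsTorsionGaloisRep 3 ρ) :
    FramedGaloisRep.IsOdd ρ := by
  sorry

/-- **H1** per-`σ` form of Gelbart Prop. 1.4: the tree proof
`ModPGaloisRep.isModular_of_isAbsolutelyIrreducible_of_isOdd_of_langlands_tunnell` uses `hLT` ONLY at
`σ = modThreeLift ρ̄` — generalise its hypothesis (same 100-line body, `hLT σ hirrσ hoddσ hsolv` ↦
`hLT hirrσ hoddσ hsolv`). S (a `ledger patch` of the Literature file, old name kept as corollary). -/
theorem isModular_of_langlands_tunnell_modThreeLift (ρ : ModPGaloisRep ℚ (ZMod 3) 2)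
    (hLT : langlands_tunnell (modThreeLift ρ)) (habs : FramedRep.IsAbsolutelyIrreducible ρ)
    (hodd : FramedGaloisRep.IsOdd ρ) : ρ.IsModular := by
  sorry

/-- **H2a** a homomorphism from a copy of `A₄` to a commutative group, all of whose values square
to `1`, is trivial (`A₄` is generated by its 3-cycles — Mathlib
`Equiv.Perm.closure_three_cycles_eq_alternating`, `IsThreeCycle.orderOf`; so `f p` has order
dividing `gcd(2,3) = 1`). S–M. -/
theorem monoidHom_eq_one_of_alternatingGroup_four {P M : Type*} [Group P] [CommGroup M]
    (e : P ≃* alternatingGroup (Fin 4)) (f : P →* M) (hf : ∀ x, f x ^ 2 = 1) : f = 1 := by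
  sorry

/-- **H2b** a scalar element of `Ψ(GL₂(𝔽₃)) ⊂ GL₂(ℤ[√-2]) ↪ GL₂(ℂ)` has determinant `1`: the
central elements of the image are `Ψ(±1) = ±1` (`λ² ∈ {±1}`, `λ ∈ ℤ[√-2]` forces `λ = ±1`);
`decide`/`fin_cases` over `M2.elems` after `psi_injective`-style unfolding. S–M. -/
theorem det_psi_eq_one_of_mem_center (g : GL (Fin 2) (ZMod 3))
    (hg : psi g ∈ Subgroup.center (GL (Fin 2) ℂ)) :
    Matrix.GeneralLinearGroup.det (psi g) = 1 := by
  sorry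

/-- **H2c** `det Ψ(g) = ±1` (tree: `det_lift_eq_one_or`), hence squares to `1`. S. -/
theorem det_psi_sq_eq_one (g : GL (Fin 2) (ZMod 3)) :
    Matrix.GeneralLinearGroup.det (psi g) ^ 2 = 1 := by
  sorry

/-- **H2** an ODD `ρ̄ : Γ_ℚ → GL₂(𝔽₃)` has complex lift `σ = Ψ ∘ ρ̄` NOT of tetrahedral type.
`det ∘ σ` is `±1`-valued (H2c) and kills the centre of `im σ` (H2b), so it factors through the
projective image (`rangeToProjectiveImage`, `mem_center_of_mem_ker_rangeToProjectiveImage`); were that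
`≅ A₄`, H2a would give `det σ ≡ 1`, contradicting `det σ(c) = -1` (`isOdd_modThreeLift`,
`exists_isComplexConjugation (Rat.castHom ℝ)`).  Print: Gelbart 1997 §1.4 Step 2 (image of `σ` in
`PGL₂(ℂ)` is a subgroup of `S₄`; preimage of `A₄` is `SL₂(𝔽₃)`).  M. -/
theorem not_isTetrahedralType_modThreeLift_of_isOdd (ρ : ModPGaloisRep ℚ (ZMod 3) 2)
    (hodd : FramedGaloisRep.IsOdd ρ) : ¬ IsTetrahedralType (modThreeLift ρ).toMonoidHom := by
  sorry

/-- **H3** Langlands–Tunnell for a NON-tetrahedral `σ` from the dihedral and octahedral cases of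
strong Artin and Gelbart's Prop. 4.2: copy `langlands_tunnell_of_strongArtin` /
`strongArtin_of_isSolvable_of_three_cases`, case-splitting with the PROVED trichotomy
`projectiveType_of_isIrreducible_of_isSolvable'` (`finite_range_toMonoidHom`,
`isSolvable_projectiveImage_iff`, `isIrreducible_toStdRepresentation_iff`) and the PROVED
`frobSatakeCompatibleAt_of_isPiOfArtinRep_holds`; the tetrahedral branch is `absurd`. S–M. -/
theorem langlands_tunnell_of_not_isTetrahedralType (hd : strongArtin_of_isDihedralType)
    (ho : strongArtin_of_isOctahedralType) (hW1 : exists_isNewform1_of_isPiOfArtinRep)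
    (σ : FramedArtinRep ℚ 2) (hσ : ¬ IsTetrahedralType σ.toMonoidHom) : langlands_tunnell σ := by
  sorry

/-- **H4 (assembly, Plan A)**: the stub from THREE named facts (dihedral strong Artin, Tunnell's
octahedral case, the weight-one dictionary) — Langlands' tetrahedral theorem
`strongArtin_of_isTetrahedralType` is NOT needed for `ρ̄_{E,3}`. Real proof. -/
theorem stub_modThree_of_dihedral_octahedral (hd : strongArtin_of_isDihedralType)
    (ho : strongArtin_of_isOctahedralType) (hW1 : exists_isNewform1_of_isPiOfArtinRep) :
    StubModThree := by
  intro W _ ρ hρ habs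
  have hodd := isOdd_of_isTorsionGaloisRep_three W ρ hρ
  exact isModular_of_langlands_tunnell_modThreeLift ρ
    (langlands_tunnell_of_not_isTetrahedralType hd ho hW1 _
      (not_isTetrahedralType_modThreeLift_of_isOdd ρ hodd)) habs hodd

/-! ## Plan C — Serre / Khare–Wintenberger applied to `ρ̄` itself (no complex lift) -/

/-- **C1** the stub's conclusion for ANY odd absolutely irreducible `ρ̄ : Γ_ℚ → GL₂(𝔽₃)` from the
weak form of Serre's conjecture at `p = 3` (tree named fact `exists_newform_of_odd_irreducible`,
lang.S37 = Khare–Wintenberger (I) Thm. 1.2, over an algebraically closed discrete `k ⊇ 𝔽₃`): in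
`IsModular` take `K := k`, `j := algebraMap 𝔽₃ k = ZMod.castHom …`; irreducibility of `ρ̄ ⊗ k` is
`habs k j` (`toRepresentation_baseChange`), oddness is preserved (`det` commutes with `map j`), the
weight is `≥ 1` because a weight-`0` cusp form is `0` and a newform is not. S–M.
Print: Buzzard, *Potential modularity* (arXiv:1101.0097) p. 10: "nowadays we do not have to rely on
the Langlands–Tunnell theorem … apply Khare–Wintenberger to `E[p]`". -/
theorem isModular_of_exists_newform_of_odd_irreducible {k : Type} [Field k] [TopologicalSpace k]
    [DiscreteTopology k] [CharP k 3] [IsAlgClosed k]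
    (hS : exists_newform_of_odd_irreducible (p := 3) (k := k)) (ρ : ModPGaloisRep ℚ (ZMod 3) 2)
    (habs : FramedRep.IsAbsolutelyIrreducible ρ) (hodd : FramedGaloisRep.IsOdd ρ) :
    ρ.IsModular := by
  sorry

/-- **C1 assembly**: with `k := AlgebraicClosure (ZMod 3)` carrying the discrete topology. Real proof
modulo H0 and C1. -/
theorem stub_modThree_of_serre
    (hS : ∀ (k : Type) [Field k] [TopologicalSpace k] [DiscreteTopology k] [CharP k 3]
      [IsAlgClosed k], exists_newform_of_odd_irreducible (p := 3) (k := k)) :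
    StubModThree := by
  intro W _ ρ hρ habs
  letI : TopologicalSpace (AlgebraicClosure (ZMod 3)) := ⊥
  haveI : DiscreteTopology (AlgebraicClosure (ZMod 3)) := ⟨rfl⟩
  haveI : CharP (AlgebraicClosure (ZMod 3)) 3 :=
    (RingHom.charP_iff_charP (algebraMap (ZMod 3) (AlgebraicClosure (ZMod 3))) 3).mp inferInstance
  exact isModular_of_exists_newform_of_odd_irreducible (hS (AlgebraicClosure (ZMod 3))) ρ habs
    (isOdd_of_isTorsionGaloisRep_three W ρ hρ)

/- **C2** (not elaborated here only because `OddArtinWeightOne` is unbuilt on today's farm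
snapshot): `theorem stub_modThree_of_khareWintenberger_weightOne (hKW : khareWintenberger_weightOne_of_isOdd) :
StubModThree := stubModThree_of_langlands_tunnell (langlands_tunnell_of_weightOne_of_isOdd hKW)` —
both constants exist in `Literature.NumberTheory.Automorphic.OddArtinWeightOne` (lines 98, 130). -/

/-! ## Plan B — the dihedral half with NO automorphic named fact (Hecke–Shimura CM theta series) -/

/-- **B1** (group theory) if `ρ̄` is odd and `Ψ ∘ ρ̄` is of dihedral type then there is an index-two
subgroup `H ≤ Γ_ℚ` containing no complex conjugation (its fixed field is IMAGINARY quadratic) on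
which `ρ̄` is abelian: `c̄` is a transposition in `PGL₂(𝔽₃) ≅ S₄`, i.e. a reflection of the
dihedral projective image `D_m`; take `H` = preimage of the rotation subgroup (for `m = 2`, of the
one of the three index-two subgroups not containing the image of `c`; Kani 2014 Prop. 11 (c)).
Tree: `exists_monomial_of_isDihedralType` gives an `H` but does not control `c`. M. -/
theorem exists_indexTwo_abelian_avoiding_conj (ρ : ModPGaloisRep ℚ (ZMod 3) 2)
    (hodd : FramedGaloisRep.IsOdd ρ) (hD : IsDihedralType (modThreeLift ρ).toMonoidHom) :
    ∃ H : Subgroup (Field.absoluteGaloisGroup ℚ), H.index = 2 ∧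
      (∀ (φ : ℚ →+* ℝ) (c : Field.absoluteGaloisGroup ℚ), IsComplexConjugation φ c → c ∉ H) ∧
      ∀ h ∈ H, ∀ h' ∈ H, ρ h * ρ h' = ρ h' * ρ h := by
  sorry

/-- **B2** (class field theory + Teichmüller lift — the HEART of Plan B) for an imaginary quadratic
`K` on whose Galois group `ρ̄` is abelian, a Grössencharakter `ψ` of `K` of type `(1, 0)`
(`k = 2` in the tree's `IsGrossencharakter` convention), some modulus `𝔪`, with the EXACT
`Γ₀`-Nebentypus clause of `Ribet1977_cmNewform_gamma0_of_isGrossencharakter`, whose Frobenius sums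
`∑_{Nv = p} ψ(v)` are algebraic integers reducing modulo a prime `𝔓 | 3` of `ℤ̄` to
`tr ρ̄(Frob_p)`, at every `p ∤ 3·D·N𝔪`, where `ρ̄` is unramified.  Construction: `χ̄ = ρ̄|_{G_K}`-
eigencharacter; `ψ := ω(χ̄ λ̄⁻¹) · λ` with `λ` any type-`(1,0)` Grössencharakter
(`HeckeCharacter.exists_of_unitaryArchParams_iff_holds`, `exists_hasInfinityType_pos_zero_unramified`)
and `ω` the Teichmüller lift (`exists_teichmullerCharacter`, `FramedGaloisRep.exists_artinLift_of_isDihedralType`);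
the Nebentypus clause = `det ρ̄ = χ̄₃` lifted (`ψ|_ℚ · | |⁻¹` has 3-power order and conductor prime to
3 ⇒ trivial).  L–XL. -/
theorem exists_grossencharakter_lift (K : Type) [Field K] [NumberField K]
    (hK : Module.finrank ℚ K = 2) [IsTotallyComplex K]
    (ρ : ModPGaloisRep ℚ (ZMod 3) 2) (hodd : FramedGaloisRep.IsOdd ρ)
    (hdet : ∀ τ, Matrix.GeneralLinearGroup.det (ρ τ) = modPCyclotomicCharacterZMod ℚ 3 τ)
    (hab : ∀ h h' : Field.absoluteGaloisGroup K,
      ρ (absGaloisRestrict ℚ K h) * ρ (absGaloisRestrict ℚ K h') =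
        ρ (absGaloisRestrict ℚ K h') * ρ (absGaloisRestrict ℚ K h)) :
    ∃ (e : K →+* ℂ) (𝔪 : Ideal (𝓞 K)) (_ : 𝔪 ≠ ⊥) (ψ : HeightOneSpectrum (𝓞 K) → ℂ)
      (𝔓 : Ideal (integralClosure ℤ ℂ)) (_ : 𝔓.IsMaximal)
      (j : ZMod 3 →+* integralClosure ℤ ℂ ⧸ 𝔓),
      IsGrossencharakter 𝔪 (fun w => (((2 : ℕ) : ℤ) - 1) * embType e w)
        (fun w => (((2 : ℕ) : ℤ) - 1) * embTypeConj e w) ψ ∧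
      (∀ n : ℕ, Odd n → n.Coprime ((discr K).natAbs * Ideal.absNorm 𝔪) →
        idealPow K ψ (Ideal.span {(n : 𝓞 K)}) = (jacobiSym (discr K) n : ℂ) * (n : ℂ) ^ (2 - 1)) ∧
      ∀ p : ℕ, p.Prime → ¬ p ∣ 3 * ((discr K).natAbs * Ideal.absNorm 𝔪) →
        ∃ a : integralClosure ℤ ℂ,
          (a : ℂ) = ∑ᶠ (v : HeightOneSpectrum (𝓞 K)) (_ : Ideal.absNorm v.asIdeal = p), ψ v ∧
          ∀ (v : HeightOneSpectrum (𝓞 ℚ)),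
            ((Rat.HeightOneSpectrum.primesEquiv v : Nat.Primes) : ℕ) = p →
            ∀ (𝔔 : Ideal (absIntegers (𝓞 ℚ) ℚ)) (_ : 𝔔 ∈ v.primesAbove)
              (τ : Field.absoluteGaloisGroup ℚ), IsArithFrobAt (𝓞 ℚ) τ 𝔔 →
              (((ρ τ : GL (Fin 2) (ZMod 3)) : Matrix (Fin 2) (Fin 2) (ZMod 3)).charpoly).map j =
                X ^ 2 - C (Ideal.Quotient.mk 𝔓 a) * X + C ((p : integralClosure ℤ ℂ ⧸ 𝔓)) := by
  sorry

end Summit.ABC.ABC.Cruxes.FreyModularity.Sketch.StubModThreeIdeasK1
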